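import Summits.KontsevichZagierPeriods.KontsevichZagierPeriods.Theorems.ValuedFieldSpecialisationCTConstructionCoreReduction
import Summits.KontsevichZagierPeriods.KontsevichZagierPeriods.Theorems.ValuedFieldSpecialisationDefs

/-!
# Route ValuedFieldSpecialisation — crux `CTConstruction`: the class core from PURE and log2-cancellation

Helper toward crux stmt-KontsevichZagierPeriods-3495 (`CTConstruction`), line `registered`, RESHAPE r3: the class core
`stub_specialFibreRigidityOfEval` of the registered skeleton (`Cruxes/CTConstruction/Lines/birth.lean`) —
"an elementary-divergent combination `D` plus a dominated combination `G` lying in the fibred relations has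
special-fibre class `y ∈ KZ.relations`" — FOLLOWS from the two kernel statements

* PURE (`stub_pureSpecialFibreRigidity`): the case `D = 0` — fibred relations among DOMINATED families specialise;
* log2-CANCELLATION (`stub_logTwoCancellation`): `[∫_{1/2}^1 dt/t] * c ∈ relations → c ∈ relations`, the analogue of
  `KZ.PiCancellation` / item `AyoubPiCancellation`;

both implied by `KZKernelConjecture`, neither refutable without refuting the summit. Proof (DILATION ELIMINATION):
write `D = Σ mᵢ [Pᵢ]` over elementary generators (`mem_closure_elementaryGenerators_iff`), bring the exponents to a
common denominator `Q` (`elementary_domain_eq_typed_empty`), choose the universe of typed families reachable from the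
`Pᵢ` under the dilation `Θ = slabMap 0 1 ∘ dilate(2^{-Q})` (`stub_typedExpansion`, `stub_exists_dilate`) and run the
main induction `coreReduction_main` (file `…CTConstructionCoreReduction`) from the initial state. The value hypothesis
`eval y = 0` of the core is not used (it is implied: value shadow).

Main statement: `specialFibreRigidityOfEval_of_pure_of_logTwoCancellation` (registered as `stub_coreReduction`).
Sources: M. Kontsevich, D. Zagier, *Periods* (2001), §1.2; the encoding is this route's. No definitions.
-/

noncomputable section

namespace Summit.KontsevichZagierPeriods.ValuedFieldSpecialisation

open MeasureTheory Set Filter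
open scoped Topology
open Literature.NumberTheory.Transcendental Literature.NumberTheory.Transcendental.KZ

/-- **The class core from PURE and log2-cancellation** (reshape r3 of line `registered`, crux `CTConstruction`).
[folklore] -/
theorem specialFibreRigidityOfEval_of_pure_of_logTwoCancellation (hPURE : ∀ (G y : Literature.NumberTheory.Transcendental.KZ.FormalRep), (G, y) ∈ AddSubgroup.closure {v : Literature.NumberTheory.Transcendental.KZ.FormalRep × Literature.NumberTheory.Transcendental.KZ.FormalRep | ∃ (n : ℕ) (S : Literature.NumberTheory.Transcendental.KZ.IntegralRep (n + 1)) (r₀ g : Literature.NumberTheory.Transcendental.KZ.IntegralRep n), Literature.NumberTheory.Transcendental.KZ.IsDominatedFamily S r₀ g ∧ v = (Literature.NumberTheory.Transcendental.KZ.of S, Literature.NumberTheory.Transcendental.KZ.of r₀)} → G ∈ Literature.NumberTheory.Transcendental.KZ.fibredRelations → y ∈ Literature.NumberTheory.Transcendental.KZ.relations) (hL2C : ∀ (L : Literature.NumberTheory.Transcendental.KZ.IntegralRep 1), L.domain = {t | (1 / 2 : ℝ) ≤ t 0 ∧ t 0 ≤ 1} → L.integrand = (fun t => (t 0)⁻¹)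 → ∀ c : Literature.NumberTheory.Transcendental.KZ.FormalRep, Literature.NumberTheory.Transcendental.KZ.of L * c ∈ Literature.NumberTheory.Transcendental.KZ.relations → c ∈ Literature.NumberTheory.Transcendental.KZ.relations) :
    ∀ D ∈ AddSubgroup.closure Summit.KontsevichZagierPeriods.ValuedFieldSpecialisation.elementaryGenerators, ∀ (G y : Literature.NumberTheory.Transcendental.KZ.FormalRep), (G, y) ∈ AddSubgroup.closure {v : Literature.NumberTheory.Transcendental.KZ.FormalRep × Literature.NumberTheory.Transcendental.KZ.FormalRep | ∃ (n : ℕ) (S : Literature.NumberTheory.Transcendental.KZ.IntegralRep (n + 1)) (r₀ g : Literature.NumberTheory.Transcendental.KZ.IntegralRep n), Literature.NumberTheory.Transcendental.KZ.IsDominatedFamily S r₀ g ∧ v = (Literature.NumberTheory.Transcendental.KZ.of S, Literature.NumberTheory.Transcendental.KZ.of r₀)} → D + G ∈ Literature.NumberTheory.Transcendental.KZ.fibredRelations → Literature.NumberTheory.Transcendental.KZ.eval y = 0 → y ∈ Literature.NumberTheory.Transcendental.KZ.relations := by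
  intro D hD G y hGy hF _heval
  classical
  obtain ⟨k, m, p₀, q, b, d, r, P, hP, rfl⟩ := (mem_closure_elementaryGenerators_iff D).mp hD
  -- common denominator of the exponents
  set Q : ℕ := ∏ i, q i with hQdef
  have hQ : 0 < Q := Finset.prod_pos fun i _ => (hP i).1
  have hqQ : ∀ i, q i ∣ Q := fun i => Finset.dvd_prod_of_mem _ (Finset.mem_univ i)
  let p : Fin k → ℕ := fun i => p₀ i * (Q / q i)
  -- a generatorwise choice of dilates by `μ = 2^{-Q}`
  have hdil : ∀ (n : ℕ) (ρ : IntegralRep (n + 1)), ∃ ρ' : IntegralRep (n + 1),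
      ρ'.domain = {z | Function.update z 0 ((((1 / 2 : ℚ) ^ Q : ℚ) : ℝ) * z 0) ∈ ρ.domain} ∧
      ρ'.integrand = fun z => ρ.integrand (Function.update z 0 ((((1 / 2 : ℚ) ^ Q : ℚ) : ℝ) * z 0)) :=
    fun n ρ => stub_exists_dilate ((1 / 2 : ℚ) ^ Q) (half_pow_pos Q) n ρ
  choose dil hdd hdi using hdil
  let T : (Σ n, IntegralRep n) → FormalRep := fun x => match x with
    | ⟨0, _⟩ => 0
    | ⟨n + 1, ρ⟩ => of (dil n ρ)
  have hT0 : ∀ ρ : IntegralRep 0, T ⟨0, ρ⟩ = 0 := fun _ => rfl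
  have hT : ∀ (n : ℕ) (ρ : IntegralRep (n + 1)), ∃ ρ' : IntegralRep (n + 1), T ⟨n + 1, ρ⟩ = of ρ' ∧
      ρ'.domain = {z | Function.update z 0 ((((1 / 2 : ℚ) ^ Q : ℚ) : ℝ) * z 0) ∈ ρ.domain} ∧
      ρ'.integrand = fun z => ρ.integrand (Function.update z 0 ((((1 / 2 : ℚ) ^ Q : ℚ) : ℝ) * z 0)) :=
    fun n ρ => ⟨dil n ρ, rfl, hdd n ρ, hdi n ρ⟩
  -- the generators are the typed families of shape `∅`
  have hPtd : ∀ i, (P i).domain = {z | ∃ (s u : ℝ) (t : Fin (b i) → ℝ) (w : Fin (d i) → ℝ), z = Matrix.vecCons s (Matrix.vecCons u (Fin.append t w)) ∧ 0 < s ∧ s < 1 ∧ 0 < u ∧ u ^ Q * s ^ (p i) < 1 ∧ (∀ j, ((if j ∈ (∅ : Finset (Fin (b i))) then (1 / 2 : ℚ) ^ Q else 1 : ℚ) : ℝ) * s ^ (if j ∈ (∅ : Finset (Fin (b i))) then 0 else 1) ≤ t j ∧ t j ≤ 1) ∧ w ∈ (r i).domain} :=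
    fun i => elementary_domain_eq_typed_empty (hP i).1 hQ (hqQ i) (r i) (P i) (hP i).2.2.1
  -- the universe of typed families reachable from the generators
  have hRep : ∀ (i : Fin k) (S : Finset (Fin (b i))), ∃ R : IntegralRep (b i + d i + 1 + 1),
      R.domain = {z | ∃ (s u : ℝ) (t : Fin (b i) → ℝ) (w : Fin (d i) → ℝ), z = Matrix.vecCons s (Matrix.vecCons u (Fin.append t w)) ∧ 0 < s ∧ s < 1 ∧ 0 < u ∧ u ^ Q * s ^ (p i) < 1 ∧ (∀ j, ((if j ∈ S then (1 / 2 : ℚ) ^ Q else 1 : ℚ) : ℝ) * s ^ (if j ∈ S then 0 else 1) ≤ t j ∧ t j ≤ 1) ∧ w ∈ (r i).domain} ∧ R.integrand = (fun z => (∏ j : Fin (b i), (z (Fin.castAdd (d i) j).succ.succ)⁻¹) * (r i).integrand (fun l : Fin (d i) => z (Fin.natAdd (b i) l).succ.succ)) := by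
    intro i S
    obtain ⟨f, hf, -⟩ := stub_typedExpansion Q (p i) (2 ^ p i) (b i) (d i) ((1 / 2 : ℚ) ^ Q) (r i) ∅ (P i)
      ((dil _ (P i)).slabRestrict 0 1) (half_pow_pos Q) (half_pow_le_one Q) (pow_pos two_pos _)
      (two_pow_pow_mul_half_pow_pow Q (p i)) (hPtd i) (hP i).2.2.2
      (by rw [IntegralRep.domain_slabRestrict, hdd]) (by rw [IntegralRep.integrand_slabRestrict, hdi])
    exact ⟨f S, (hf S (Finset.empty_subset S)).1, (hf S (Finset.empty_subset S)).2⟩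
  choose Rep hRd hRi using hRep
  -- the initial state
  let c₀ : (i : Fin k) → Finset (Fin (b i)) → ℤ := fun i S => if S = ∅ then m i else 0
  have hRep0 : ∀ i, Rep i ∅ = P i := fun i =>
    IntegralRep.ext' ((hRd i ∅).trans (hPtd i).symm) ((hRi i ∅).trans (hP i).2.2.2.symm)
  have hD0 : (∑ i, ∑ S : Finset (Fin (b i)), c₀ i S • of (Rep i S)) = ∑ i, m i • of (P i) := by
    refine Finset.sum_congr rfl fun i _ => ?_
    rw [Finset.sum_eq_single_of_mem ∅ (Finset.mem_univ _) (fun S _ hS => by simp [c₀, hS])]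
    simp [c₀, hRep0]
  have hInv0 : ∀ i S, p i = 0 → c₀ i S ≠ 0 → S ≠ Finset.univ := by
    intro i S hpi hS
    have hS0 : S = ∅ := by by_contra h; simp [c₀, h] at hS
    subst hS0
    have hdiv : Q / q i ≠ 0 := by
      obtain ⟨e, he⟩ := hqQ i
      rw [he, Nat.mul_div_cancel_left _ (hP i).1]
      rintro rfl
      rw [mul_zero] at he
      exact hQ.ne' he
    have hp0 : p₀ i = 0 := by
      rcases Nat.mul_eq_zero.mp (show p₀ i * (Q / q i) = 0 from hpi) with h | h
      · exact h
      · exact absurd h hdiv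
    have hb : 0 < b i := (hP i).2.1.resolve_left (by omega)
    intro h
    have := congrArg Finset.card h
    simp at this
    omega
  refine coreReduction_main hQ hPURE hL2C hRd hRi hT0 hT c₀ hInv0 G y hGy ?_
  rw [hD0]
  exact hF

/-- **Registered stub `stub_coreReduction`** (crux `CTConstruction`, line `registered`, reshape r3): PURE →
log2-CANCELLATION → the class core `stub_specialFibreRigidityOfEval` (verbatim signatures). [folklore] -/
theorem stub_coreReduction : (∀ (G y : Literature.NumberTheory.Transcendental.KZ.FormalRep), (G, y) ∈ AddSubgroup.closure {v : Literature.NumberTheory.Transcendental.KZ.FormalRep × Literature.NumberTheory.Transcendental.KZ.FormalRep | ∃ (n : ℕ) (S : Literature.NumberTheory.Transcendental.KZ.IntegralRep (n + 1)) (r₀ g : Literature.NumberTheory.Transcendental.KZ.IntegralRep n), Literature.NumberTheory.Transcendental.KZ.IsDominatedFamily S r₀ g ∧ v = (Literature.NumberTheory.Transcendental.KZ.of S, Literature.NumberTheory.Transcendental.KZ.of r₀)} → G ∈ Literature.NumberTheory.Transcendental.KZ.fibredRelations → y ∈ Literature.NumberTheory.Transcendental.KZ.relations) → (∀ (L : Literature.NumberTheory.Transcendental.KZ.IntegralRep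 1), L.domain = {t | (1 / 2 : ℝ) ≤ t 0 ∧ t 0 ≤ 1} → L.integrand = (fun t => (t 0)⁻¹) → ∀ c : Literature.NumberTheory.Transcendental.KZ.FormalRep, Literature.NumberTheory.Transcendental.KZ.of L * c ∈ Literature.NumberTheory.Transcendental.KZ.relations → c ∈ Literature.NumberTheory.Transcendental.KZ.relations) → ∀ D ∈ AddSubgroup.closure Summit.KontsevichZagierPeriods.ValuedFieldSpecialisation.elementaryGenerators, ∀ (G y : Literature.NumberTheory.Transcendental.KZ.FormalRep), (G, y) ∈ AddSubgroup.closure {v : Literature.NumberTheory.Transcendental.KZ.FormalRep × Literature.NumberTheory.Transcendental.KZ.FormalRep | ∃ (n : ℕ) (S : Literature.NumberTheory.Transcendental.KZ.IntegralRep (n + 1)) (r₀ g : Literature.NumberTheory.Transcendental.KZ.IntegralRep n), Literature.NumberTheory.Transcendental.KZ.IsDominatedFamily S r₀ g ∧ v = (Literature.NumberTheory.Transcendental.KZ.of S, Literature.NumberTheory.Transcendental.KZ.of r₀)} → D + G ∈ Literature.NumberTheory.Transcendental.KZ.fibredRelations → Literature.NumberTheory.Transcendental.KZ.eval y = 0 →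 y ∈ Literature.NumberTheory.Transcendental.KZ.relations :=
  specialFibreRigidityOfEval_of_pure_of_logTwoCancellation

end Summit.KontsevichZagierPeriods.ValuedFieldSpecialisation
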